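import Summits.QuantumFields.YangMills.Theses.LuscherReduction
import Summits.QuantumFields.YangMills.Theorems.FemtoTransferGapBounds
import Summits.QuantumFields.YangMills.Theorems.LuscherReductionOneSiteLevelsVariational
import Summits.QuantumFields.YangMills.Theorems.LuscherReductionOneSiteLevelsIMS
import Summits.QuantumFields.YangMills.Theorems.FemtoTransferGapRungW1up
import Summits.QuantumFields.YangMills.Theorems.LuscherReductionOneSiteLevelsPhase
import Summits.QuantumFields.YangMills.Theorems.LuscherReductionOneSiteLevelsOuterSeam
import Summits.QuantumFields.YangMills.Theorems.LuscherReductionOneSiteLevelsValleySeam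
import Literature.Analysis.OperatorTheory.YangMillsMatrixModelEigenfunctions

/-!
(v10, owner p1 g14 2026-08-26 — REGISTERED on director-ym g5 LINE №82 authorisation (second located reshape this generation; supersedes v9 d27be47115354824 which was
of record and mirrored in the tree): = v9 ∘ (VALLEY ↦ the fleet lead's CONCRETE VALLEY `stub_absUpperValleyMag`, v9-draft 4759daa8827ced42, seam
`absUpperOuter_of_valleyMag` p449656).  ACTIVE (sorry'd) stubs: stub_eigenAL1 (fact), stub_absUpperInnerAL1 (XL), stub_absUpperValleyMag (L),
stub_absLowerAL1 (L), stub_rungK1.)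

(v9, 2026-08-26 planner ym-beyond-p1 g14 — ROUTE OWNER, REGISTERED: the ONE reshape of this generation, answering the LOCATED findings of both
fleet seats in one cut.  (a) = the fleet lead's v7/v8 re-cuts, ADOPTED as drafted: `stub_absUpper` ⟶ INNER + OUTER along the landed composition
`absUpper_of_inner_outer` (`Theorems/LuscherReductionOneSiteLevelsPhase.lean`, p445538), OUTER ⟶ VALLEY along the landed seam
`absUpperOuter_of_valley` (`Theorems/LuscherReductionOneSiteLevelsOuterSeam.lean`, p447496), and `abbrev oneLinkFactor := linkC` (rfl-equal;
fixes the `SU2` ambiguity under the chain's imports).  (b) = seat ym-luscher-20007-p2's D-0014 flag (12:58:36Z) and the lead's card v2 §2: the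
quasimode floors AND the INNER no-intruder comparison (its `k` constraint functions and its flat-side lower bound come from the eigenfunctions of
`𝔥`) lean on the reviewed NAMED LITERATURE FACT AL1 `LuscherHamiltonianEigenfunctions` (`Literature/Analysis/OperatorTheory/
YangMillsMatrixModelEigenfunctions.lean`, p441424: Reed–Simon XIII.64 + Agmon + Gilbarg–Trudinger; KNOWN mathematics, not formalised).  AL1 is
therefore THREADED EXPLICITLY: one fact stub `stub_eigenAL1 : ∀ k, LuscherHamiltonianEigenfunctions k` (NOT a prover target — see its docstring)
and the two eigenfunction-consuming stubs carry it as hypothesis, family form: `stub_absUpperInnerAL1 : (∀ k, LuscherHamiltonianEigenfunctions k)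
→ ∀ k, OneSiteAbsUpperInner k` (XL core) and `stub_absLowerAL1 : (∀ k, LuscherHamiltonianEigenfunctions k) → ∀ k, OneSiteAbsLower k` (L) — a
prover's `(h : LuscherHamiltonianEigenfunctions k) → OneSiteAbsLower k` discharges the latter as `fun hAL1 k => thm (hAL1 k)`, an AL1-free proof as
`fun _ => thm`.  The registered v5/v6 stubs `stub_absUpper` / `stub_absLower` and the v7 name `stub_absUpperOuter` are DISCHARGED modulo
{InnerAL1, Valley, eigenAL1} / {LowerAL1, eigenAL1} / {Valley}; `stub_absUpperValley : ∀ k, OneSiteAbsUpperValley k` (L; transverse zero-point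
confinement along the commuting-triple valley, no eigenfunctions needed) and the BC5 rung `stub_rungK1 : FemtoGapOneSite` stay hypothesis-free.
Composition `OneSiteLevels_of` and every registered statement of v3–v6 are BYTE-IDENTICAL.  Sorries (= ACTIVE stubs): stub_eigenAL1 (fact),
stub_absUpperInnerAL1 (XL), stub_absUpperValley (L), stub_absLowerAL1 (L), stub_rungK1 (plan-only rung).  CONSEQUENCE RECORDED (for
director/referee): as typed, crux ONE — hence the rung leaf — closes UNCONDITIONALLY only if AL1 is formalised; every analytic stub closes as a
theorem with the printed-fact hypothesis `(h : LuscherHamiltonianEigenfunctions k)` (THE MODEL's sanctioned shape), and the conditional closure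
`(∀ k, AL1 k) → OneSiteLevels` is kernel-checked below as `OneSiteLevels_of_AL1`.)
(v8 DRAFT, 2026-08-26 fleet lead prover ym-luscher-20007-p1 g0: = v7 + `stub_absUpperOuter` DISCHARGED modulo the NEW stub
`stub_absUpperValley : ∀ k, OneSiteAbsUpperValley k` by the landed OUTER seam `absUpperOuter_of_valley`
(`Theorems/LuscherReductionOneSiteLevelsOuterSeam.lean`, p447496; large fields by `…LargeField.lean` p445976): VALLEY = «there is a magnetic
localisation (second angular IMS cut `Φ_B`: measurable, gauge/twist-invariant, link-Lipschitz with `Λ′² ≤ A′/λ_b`, `sin`-piece in `{S ≥ η_B}` with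
`e^{−Bη_B}` below the target rate) whose valley piece `cos Φ_B · sin Θ_B · ψ` obeys the rate `linkCE·e^{−E_kλ_b + C₁λ_b²}`» — the transverse
zero-point confinement near the commuting-triple valley at distance `≥ √λ_b` from the torons (L).  Sorries: stub_absUpperInner (XL core),
stub_absUpperValley (L), stub_absLower (quasimodes; lit g6 ℝ⁹-side landed, lattice doors landed), stub_rungK1.)
(v7 DRAFT, 2026-08-26 fleet lead prover ym-luscher-20007-p1 g0 — FOR THE OWNER TO ADOPT/REGISTER OR REJECT: = v6 + the hard stub
`stub_absUpper` RE-CUT into the two analytic sub-stubs fixed by the landed composition `absUpper_of_inner_outer`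
(`Theorems/LuscherReductionOneSiteLevelsPhase.lean`; IMS at scale `ℓ(B) = √λ_b` with the phase `onePhase`, defs p444941; error `O(λ_b²)·c(B)³`
by `Theorems/LuscherReductionOneSiteLevelsIMSDefect.lean` p444348 and `…AbsUpperSeam.lean` p444620):
`stub_absUpperInner : ∀ k, OneSiteAbsUpperInner k` (XL CORE: Kac/Trotter comparison with `e^{−λ_b𝔥}` on the toron balls — `k` physical constraints
control the `cos Θ_B`-piece of every physical `ψ ⊥ φ_i` at rate `linkCE B·e^{−E_kλ_b + Cλ_b²}`) and `stub_absUpperOuter : ∀ k, OneSiteAbsUpperOuter k`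
(L: transverse confinement along the toron valley + `e^{−BS}` suppression — the `sin Θ_B`-piece of every physical `ψ` at the same-shape rate);
`stub_absUpper` is DISCHARGED modulo them.  Also `oneLinkFactor` is now an `abbrev` for the chain's `linkC` (fixes the `SU2` name ambiguity
that the chain's imports introduce into v6; `rfl`-equal to the v5 body).  Sorries: stub_absUpperInner, stub_absUpperOuter, stub_absLower, stub_rungK1.)
(v6 DRAFT, 2026-08-26 planner ym-beyond-p1 g13 — TO BE REGISTERED BY THE OWNER SEAT ONLY AFTER the 7-module chain
`Theorems/FemtoTransferGapRungW1up{Algebra,Link,Deficit,Site,Profiles,Trial,}.lean` (HOME/p1-g13-files) is ACCEPTED in the tree: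
= v5 (registered 40df15b32d4f877b) + the import of `…Theorems.FemtoTransferGapRungW1up` + `stub_rungW1up` DISCHARGED BY NAME with the
sorry-free theorem `Summit.QuantumFields.YangMills.Theorems.FemtoTransferGap.rungUpperK1` (Schur bound upward + disjoint ball/annulus
class-function trial pair downward; statement verbatim `RungUpperK1`).  Nothing else changes; sorries remain only in `stub_absUpper`,
`stub_absLower`, `stub_rungK1`.)
(v5, 2026-08-26 fleet lead prover ym-luscher-20007-p1 g0 — FOR THE OWNER (p1 g13) TO ADOPT/REGISTER OR REJECT: the two registered
stubs `stub_oneSiteEnergyLower/Upper` are RE-CUT along the difficulty seam into `stub_absUpper : ∀ k, OneSiteAbsUpper k` (absolute upper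
bounds `μ_k ≤ c(B)³e^{−E_kλ_b + Cλ_b²}` against the one-link normaliser `c(B) = ∫e^{B Re tr W}dW` — the HARD half: IMS localisation, no
intruders; line card `Lines/energy-lower-abs.md`) and `stub_absLower : ∀ k, OneSiteAbsLower k` (quasimode floors `c(B)³e^{−E_kλ_b − Cλ_b²} ≤ μ_k`);
`stub_oneSiteEnergyLower/Upper` are then DISCHARGED by the landed seams `oneSite_energyLower_of_abs` / `oneSite_energyUpper_of_abs`
(`Theorems/LuscherReductionOneSiteLevelsVariational.lean`, p438063); composition `OneSiteLevels_of` byte-identical to v4; `stub_rungK1`,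
`stub_rungW1up` unchanged.  New defs: `oneLinkFactor`, `OneSiteAbsUpper`, `OneSiteAbsLower` (+ `Stmt.stub_absUpper/Lower`).)
(v4, 2026-08-26 planner ym-beyond-p1 g12: + BC5 rung stub `stub_rungW1up : RungUpperK1` — the ORDER-OF-MAGNITUDE gap-UPPER-bound
(quasimode) half of witness W1 at `k = 1`, `e^{−Cλ_b} λ₀ ≤ λ₁` eventually in `B` — with the proved seam `rungW1up_of_oneSiteLevels :
OneSiteLevels → RungUpperK1` (a strict corollary of the crux; NOT used in the composition); stubs `stub_oneSiteEnergyLower/Upper/rungK1`,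
their signatures and the composition `OneSiteLevels_of` are BYTE-IDENTICAL to v3.)
(v3, 2026-08-26T00:5xZ: stub `stub_oneSiteTopPos` discharged by name from `Theorems.FemtoTransferGapBounds` — p413762; stub set, signatures and composition UNCHANGED.)
# Birth skeleton (BC3) of crux `OneSiteLevels` of route `LuscherReduction` (QuantumFields / YangMills; rung leaf R2b1 `FemtoGapOfRecord`)
Planner ym-beyond-p1 g10, 2026-08-25.  Publish after `route open` with
`ledger crux write <item> Lines/birth.lean --file Lines-birth-OneSiteLevels.lean` and register with
`ledger skeleton check $(ledger crux dir <item>)/Lines/birth.lean --crux <item>`.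
Sorries live ONLY inside `stub_*`; the composition `OneSiteLevels_of` is kernel-checked and concludes the route decl
`Summit.QuantumFields.YangMills.Theses.LuscherReduction.OneSiteLevels` BY NAME.
-/

set_option autoImplicit false

noncomputable section

open MeasureTheory Filter Topology Real
open Literature.MathematicalPhysics.QuantumFieldTheory
open Literature.MathematicalPhysics.QuantumLattice
open Literature.Analysis.OperatorTheory.YMMatrixModel

/-! ## BC3 birth skeleton for crux `OneSiteLevels` (planner ym-beyond-p1 g10, 2026-08-25)
Three stubs and the kernel-checked composition `OneSiteLevels_of`; plus the BC5 PLAN-ONLY rungs `stub_rungK1 : FemtoGapOneSite` (the `k = 1`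
upper half, the tree's one-site leaf) and — v4 — `stub_rungW1up : RungUpperK1` (the `k = 1` order-of-magnitude quasimode half, the cheapest
first rung; corollary of the crux by `rungW1up_of_oneSiteLevels`); neither is used in the composition.  The crux is a statement about ONE compact-group quantum mechanics
(`SU(2)³`, 9 degrees of freedom, transfer operator `K_B` of `Theorems.FemtoTransferGap` at `L = 1`) in the semiclassical parameter
`λ_b = (2/B)^{1/3} → 0`.  S_A1 `OneSiteTopPos`: the top zero-flux transfer value is positive (constant test function; positive kernel).
S_A2 `OneSiteEnergyLower` («no intruder states»): every zero-flux level satisfies `−log(λ_k/λ₀) ≥ λ_bΔ_k − Cλ_b²` — IMS localisation: away from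
the 8 twist copies of the classical vacuum the kernel costs `O(1) ≫ λ_b`, near them `−log K_B = λ_b𝔥 + O(λ_b²)` (harmonic/quartic approximation at
the conical valley of commuting triples) [SimonB1983DiscreteSpectrum, Thm. 1.1], [HelfferSjostrand1984].  S_A3 `OneSiteEnergyUpper`
(quasimodes): `−log(λ_k/λ₀) ≤ λ_bΔ_k + Cλ_b²` from flip-symmetrised trial states built on the first `k+1` eigenfunctions of `𝔥` in the scaling
`c = λ_b x`, min–max [ReedSimonIV1978, Thm. XIII.1–2], together with the ground-energy lower bound of S_A2 at `k = 0`. -/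
namespace Summit.QuantumFields.YangMills.Cruxes.OneSiteLevels.Birth

open Summit.QuantumFields.YangMills.Theorems.FemtoTransferGap

/-- S_A1: the one-site top zero-flux transfer value is positive for `B ≥ 1`. -/
def OneSiteTopPos : Prop :=
  ∀ B : ℝ, 1 ≤ B → 0 < levelValue su2Rep 1 B 0

/-- S_A2 (load-bearing: energy LOWER bounds, «no intruders»): `λ_k ≤ e^{−(λ_bΔ_k − Cλ_b²)} λ₀` eventually in `B`. -/
def OneSiteEnergyLower : Prop :=
  ∀ k : ℕ, ∃ C B0 : ℝ, ∀ B : ℝ, B0 ≤ B →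
    levelValue su2Rep 1 B k ≤ Real.exp (-(levelGap k * bareLambda B - C * bareLambda B ^ 2)) * levelValue su2Rep 1 B 0

/-- S_A3 (quasimodes: energy UPPER bounds): `e^{−(λ_bΔ_k + Cλ_b²)} λ₀ ≤ λ_k` eventually in `B`. -/
def OneSiteEnergyUpper : Prop :=
  ∀ k : ℕ, ∃ C B0 : ℝ, ∀ B : ℝ, B0 ≤ B →
    Real.exp (-(levelGap k * bareLambda B + C * bareLambda B ^ 2)) * levelValue su2Rep 1 B 0 ≤ levelValue su2Rep 1 B k

/-- W1up (BC5 rung, v4): ORDER-OF-MAGNITUDE UPPER BOUND ON THE ONE-SITE ZERO-FLUX GAP, `−log(λ₁/λ₀) ≤ C λ_b` eventually in `B`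
(`λ_b = (2/B)^{1/3}`), i.e. `e^{−Cλ_b} λ₀ ≤ λ₁` for the min–max values `λ_k = levelValue su2Rep 1 B k` of the one-site (`L = 1`, `SU(2)³`)
transfer kernel.  The quasimode half of W1 of the BC5 witness plan at order-of-magnitude precision: decided nowhere in print (the
one-site spectrum is known only perturbatively [Luscher1983], [LuscherMunster1984] and variationally [KollerVanbaal1986]); strictly
weaker than the crux (`rungW1up_of_oneSiteLevels`); NOT of the shape of the leaf `FemtoGapOfRecord` (a gap LOWER bound); its proof
exercises the crux's lever — `λ_b`-localised centre-symmetric class-function trial states `Π_k h((2 − |tr U_k|)/λ_b²)` (zero modes of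
width `λ_b`: kinetic deficit `O(1/(Bλ_b²)) = O(λ_b)`, magnetic cost `O(Bλ_b⁴) = O(λ_b)`), the Markov-deficit identity for the
product heat-kernel factor, and the Schur row-integral bound `λ₀ ≤ c(B)³` (`c(B) = ∫_{SU(2)} e^{B tr W} dW`, Haar translation
invariance) — see `RUNG-W1up-PLAN.md` of this seat. [cite: Luscher1983, §1] [cite: ReedSimonIV1978, Thm. XIII.1–2] -/
def RungUpperK1 : Prop :=
  ∃ C B0 : ℝ, ∀ B : ℝ, B0 ≤ B → Real.exp (-(C * bareLambda B)) * levelValue su2Rep 1 B 0 ≤ levelValue su2Rep 1 B 1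

/-- (v5) The ONE-LINK NORMALISER `c(B) = ∫_{SU(2)} e^{B Re tr W} dW`: the pure kinetic factor `T_B(U,V) = Π_k e^{B Re tr(U_kV_k⁻¹)}` has
constant row integrals `c(B)³` (Haar invariance), so `c(B)³` is its exact top eigenvalue and the natural absolute scale of every `μ_k`
(`μ_k = c(B)³ e^{−λ_b E_k + O(λ_b²)}`, `E_k = physLevel (k+1)`; no polynomial prefactor: `T_B/c(B)³` is Markov). [cite: Luscher1983, §1] -/
abbrev oneLinkFactor (B : ℝ) : ℝ := linkC B

/-- (v5) **AbsUpper k** — the HARD half of BOTH registered energy stubs («no intruder states»): the `k`-th one-site zero-flux transfer value is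
at most `c(B)³ e^{−E_k λ_b + C λ_b²}` eventually in `B`, `E_k = physLevel (k+1)` the `(k+1)`-th min–max level of Lüscher's `𝔥` over invariant
test functions.  Route to it (line card `Lines/energy-lower-abs.md`): IMS kernel localisation at link-angle scale `ℓ ≍ λ_b^{1/2}`
(`Theorems/LuscherReductionOneSiteLevelsIMS.lean`, error `O(λ_b²)`), outer bound (transverse confinement along the toron valley + `e^{−BS}`),
inner comparison of the Kac-form operator with `e^{−λ_b𝔥}` (Trotter–Kato at small time `λ_b`, relative curved/flat corrections), and the
inf–sup door `levelValue_le_of_forall_rayleigh_le`. [cite: SimonB1983DiscreteSpectrum, Cor. 4] [cite: HelfferSjostrand1984] -/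
def OneSiteAbsUpper (k : ℕ) : Prop :=
  ∃ C B0 : ℝ, ∀ B : ℝ, B0 ≤ B →
    levelValue su2Rep 1 B k ≤ oneLinkFactor B ^ 3 * Real.exp (-(physLevel (k + 1) * bareLambda B) + C * bareLambda B ^ 2)

/-- (v5) **AbsLower k** — the quasimode half of BOTH registered energy stubs: `c(B)³ e^{−E_k λ_b − C λ_b²} ≤ μ_k` eventually in `B`.  Route:
`k+1` pulled-back, twist-symmetrised, cut-off eigenfunctions of `𝔥` (needs the Literature fact «Agmon-decaying smooth invariant eigenfunctions
realising `physLevel 1..k+1`», Reed–Simon XIII + Agmon), exact magnetic identity `S(U) = 4Σ_{i<j}|u_i × u_j|²`, one-link Gaussian comparison in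
the exponential chart, and the lower-bound door `le_levelValue_of_subspace`. [cite: ReedSimonIV1978, Thm. XIII.1–2] [cite: Luscher1983, §1] -/
def OneSiteAbsLower (k : ℕ) : Prop :=
  ∃ C B0 : ℝ, ∀ B : ℝ, B0 ≤ B →
    oneLinkFactor B ^ 3 * Real.exp (-(physLevel (k + 1) * bareLambda B) - C * bareLambda B ^ 2) ≤ levelValue su2Rep 1 B k

/-- (v7) **AbsUpper INNER k** — the XL CORE of the crux: for `B ≥ B₁ ≥ 2` there are `k` physical constraint functions `φ_i` such that the
`cos Θ_B`-piece (`Θ_B = onePhase (onePhaseScale B)`: supported where every link is within `2√λ_b` of `±1`, the union of the toron balls) of every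
physical `ψ ⊥ φ_i` satisfies `⟨cos Θ_B ψ, K_B cos Θ_B ψ⟩ ≤ linkCE B · e^{−E_kλ_b + Cλ_b²} ‖cos Θ_B ψ‖²` — the Kac/Trotter comparison of `K_B/c(B)³`
with `e^{−λ_b𝔥}` at small time `λ_b` (relative curved/flat corrections), `E_k = physLevel (k+1)`. [cite: HelfferSjostrand1984] [cite: SimonB1983DiscreteSpectrum, Cor. 4] -/
def OneSiteAbsUpperInner (k : ℕ) : Prop :=
  ∃ C₁ B₁ : ℝ, 2 ≤ B₁ ∧ ∀ B, B₁ ≤ B → ∃ φs : Fin k → Cfg → ℝ, (∀ i, IsPhys (φs i)) ∧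
    ∀ ψ : Cfg → ℝ, IsPhys ψ → (∀ i, l2 ψ (φs i) = 0) →
    qform su2Rep B (fun U => Real.cos (onePhase (onePhaseScale B) U) * ψ U) (fun U => Real.cos (onePhase (onePhaseScale B) U) * ψ U)
      ≤ linkCE B * Real.exp (-(physLevel (k + 1) * bareLambda B) + C₁ * bareLambda B ^ 2)
        * l2 (fun U => Real.cos (onePhase (onePhaseScale B) U) * ψ U) (fun U => Real.cos (onePhase (onePhaseScale B) U) * ψ U)

/-- (v7) **AbsUpper OUTER k** (L): for `B ≥ B₂ ≥ 2` the `sin Θ_B`-piece (supported where some link is farther than `√λ_b` from `±1`) of every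
physical `ψ` satisfies `⟨sin Θ_B ψ, K_B sin Θ_B ψ⟩ ≤ linkCE B · e^{−E_kλ_b + Cλ_b²} ‖sin Θ_B ψ‖²` — transverse zero-point confinement along the compact
toron valley at distance `≥ √λ_b ≫ λ_b` from the torons plus `e^{−BS}` suppression off the valley (any stronger rate weakens to this one).
[cite: SimonB1983DiscreteSpectrum, §2] [cite: Luscher1983, §2] -/
def OneSiteAbsUpperOuter (k : ℕ) : Prop :=
  ∃ C₂ B₂ : ℝ, 2 ≤ B₂ ∧ ∀ B, B₂ ≤ B → ∀ ψ : Cfg → ℝ, IsPhys ψ →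
    qform su2Rep B (fun U => Real.sin (onePhase (onePhaseScale B) U) * ψ U) (fun U => Real.sin (onePhase (onePhaseScale B) U) * ψ U)
      ≤ linkCE B * Real.exp (-(physLevel (k + 1) * bareLambda B) + C₂ * bareLambda B ^ 2)
        * l2 (fun U => Real.sin (onePhase (onePhaseScale B) U) * ψ U) (fun U => Real.sin (onePhase (onePhaseScale B) U) * ψ U)

/-- (v8) **AbsUpper VALLEY k** (L): SOME magnetic localisation controls the valley piece.  There are constants `A′ ≥ 0`, `C₁`, `B₁ ≥ 2`
and families `Φ_B` (second IMS phase), `Λ′_B` (its link-Lipschitz constants), `η_B` (large-field thresholds) such that for `B ≥ B₁`: `Φ_B` is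
measurable, gauge- and twist-invariant, `|Φ_B U − Φ_B V| ≤ Λ′_B Σ_e ‖U_e − V_e‖_F`, `Λ′_B² ≤ A′/λ_b(B)`, `sin Φ_B U ≠ 0 → η_B ≤ S(U)`,
`e^{−Bη_B} ≤ e^{−E_kλ_b + C₁λ_b²}`, AND the valley piece of every physical `ψ` obeys
`⟨cos Φ_B sin Θ_B ψ, K_B cos Φ_B sin Θ_B ψ⟩ ≤ linkCE B · e^{−E_kλ_b + C₁λ_b²} ‖cos Φ_B sin Θ_B ψ‖²` (`Θ_B = onePhase (onePhaseScale B)`).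
[cite: SimonB1983DiscreteSpectrum, §2] [cite: Luscher1983, §2] -/
def OneSiteAbsUpperValley (k : ℕ) : Prop :=
  ∃ A' C₁ B₁ : ℝ, ∃ Φ : ℝ → Cfg → ℝ, ∃ Λ' η : ℝ → ℝ, 2 ≤ B₁ ∧ 0 ≤ A' ∧
    (∀ B, Measurable (Φ B)) ∧
    (∀ B (g : Site 3 1 → Theorems.FemtoTransferGap.SU2) (U : Cfg), Φ B (gaugeTransform g U) = Φ B U) ∧
    (∀ B (j : Fin 3), ∀ z ∈ Subgroup.center Theorems.FemtoTransferGap.SU2, ∀ U : Cfg, Φ B (twist j z U) = Φ B U) ∧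
    (∀ B, 0 ≤ Λ' B) ∧
    (∀ B (U V : Cfg), |Φ B U - Φ B V|
      ≤ Λ' B * ∑ e, frobNorm ((U e : Matrix (Fin 2) (Fin 2) ℂ) - (V e : Matrix (Fin 2) (Fin 2) ℂ))) ∧
    (∀ B, B₁ ≤ B → Λ' B ^ 2 ≤ A' / bareLambda B) ∧
    (∀ B, B₁ ≤ B → ∀ U : Cfg, Real.sin (Φ B U) ≠ 0 → η B ≤ wilsonAction su2Rep U) ∧
    (∀ B, B₁ ≤ B → Real.exp (-(B * η B)) ≤ Real.exp (-(physLevel (k + 1) * bareLambda B) + C₁ * bareLambda B ^ 2)) ∧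
    (∀ B, B₁ ≤ B → ∀ ψ : Cfg → ℝ, IsPhys ψ →
      qform su2Rep B (fun U => Real.cos (Φ B U) * (Real.sin (onePhase (onePhaseScale B) U) * ψ U))
          (fun U => Real.cos (Φ B U) * (Real.sin (onePhase (onePhaseScale B) U) * ψ U))
        ≤ linkCE B * Real.exp (-(physLevel (k + 1) * bareLambda B) + C₁ * bareLambda B ^ 2)
          * l2 (fun U => Real.cos (Φ B U) * (Real.sin (onePhase (onePhaseScale B) U) * ψ U))
               (fun U => Real.cos (Φ B U) * (Real.sin (onePhase (onePhaseScale B) U) * ψ U)))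

/-- (v8) The seam in the shape of the defs: VALLEY ⟹ OUTER (`absUpperOuter_of_valley`). -/
theorem absUpperOuter_of_absUpperValley (k : ℕ) (h : OneSiteAbsUpperValley k) : OneSiteAbsUpperOuter k := by
  obtain ⟨A', C₁, B₁, Φ, Λ', η, hB₁, hA', hm, hg, hz, hΛ, hLip, hΛA, hsupp, hrate, hval⟩ := h
  exact absUpperOuter_of_valley k hB₁ hA' Φ Λ' η hm hg hz hΛ hLip hΛA hsupp hrate hval

/-- (v10 = fleet lead g0 v9-draft 4759daa8827ced42) **AbsUpper VALLEY (concrete magnetic localisation) k** (L): for `B ≥ B₁ ≥ 2` the valley piece `cos Φ_B · sin Θ_B · ψ` of every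
physical `ψ` — `Φ_B = magPhase (onePhaseScale B)` (supported in `{S < 2√λ_b}`), `Θ_B = onePhase (onePhaseScale B)` (some link farther than `√λ_b`
from `±1`) — satisfies `⟨cos Φ_B sin Θ_B ψ, K_B cos Φ_B sin Θ_B ψ⟩ ≤ linkCE B · e^{−E_kλ_b + C₁λ_b²} ‖cos Φ_B sin Θ_B ψ‖²`: transverse zero-point
confinement near the commuting-triple valley (local harmonic Kac operators with frequencies `≳ √λ_b ≫ λ_b`; exact potential `4Σ|u_i × u_j|²`).
[cite: SimonB1983DiscreteSpectrum, §2] [cite: Luscher1983, §2] -/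
def OneSiteAbsUpperValleyMag (k : ℕ) : Prop :=
  ∃ C₁ B₁ : ℝ, 2 ≤ B₁ ∧ ∀ B, B₁ ≤ B → ∀ ψ : Cfg → ℝ, IsPhys ψ →
    qform su2Rep B (fun U => Real.cos (magPhase (onePhaseScale B) U) * (Real.sin (onePhase (onePhaseScale B) U) * ψ U))
        (fun U => Real.cos (magPhase (onePhaseScale B) U) * (Real.sin (onePhase (onePhaseScale B) U) * ψ U))
      ≤ linkCE B * Real.exp (-(physLevel (k + 1) * bareLambda B) + C₁ * bareLambda B ^ 2)
        * l2 (fun U => Real.cos (magPhase (onePhaseScale B) U) * (Real.sin (onePhase (onePhaseScale B) U) * ψ U))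
             (fun U => Real.cos (magPhase (onePhaseScale B) U) * (Real.sin (onePhase (onePhaseScale B) U) * ψ U))


/-! ### Registered stub statements (gate shape: each declared stub `theorem stub_<name> : Stmt.stub_<name> := by sorry`,
the composition's hypotheses are the `Stmt.stub_<name>` by name). -/
namespace Stmt

/-- = `OneSiteTopPos` (statement of the declared stub `stub_oneSiteTopPos`). -/
abbrev stub_oneSiteTopPos : Prop := OneSiteTopPos

/-- = `OneSiteEnergyLower` (statement of the declared stub `stub_oneSiteEnergyLower`). -/
abbrev stub_oneSiteEnergyLower : Prop := OneSiteEnergyLower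

/-- = `OneSiteEnergyUpper` (statement of the declared stub `stub_oneSiteEnergyUpper`). -/
abbrev stub_oneSiteEnergyUpper : Prop := OneSiteEnergyUpper

/-- = `FemtoGapOneSite` (statement of the declared stub `stub_rungK1`). -/
abbrev stub_rungK1 : Prop := FemtoGapOneSite

/-- = `RungUpperK1` (statement of the declared stub `stub_rungW1up`, v4). -/
abbrev stub_rungW1up : Prop := RungUpperK1

/-- (v5) = `∀ k, OneSiteAbsUpper k` (statement of the declared stub `stub_absUpper`). -/
abbrev stub_absUpper : Prop := ∀ k : ℕ, OneSiteAbsUpper k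

/-- (v5) = `∀ k, OneSiteAbsLower k` (statement of the declared stub `stub_absLower`). -/
abbrev stub_absLower : Prop := ∀ k : ℕ, OneSiteAbsLower k

/-- (v9) = `∀ k, LuscherHamiltonianEigenfunctions k` — the NAMED LITERATURE FACT AL1 for every level (statement of the declared
fact stub `stub_eigenAL1`; reviewed Literature p441424). -/
abbrev stub_eigenAL1 : Prop := ∀ k : ℕ, LuscherHamiltonianEigenfunctions k

/-- (v9) = `(∀ k, LuscherHamiltonianEigenfunctions k) → ∀ k, OneSiteAbsUpperInner k` (statement of the declared stub `stub_absUpperInnerAL1`: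
the v7 INNER core with AL1 threaded as hypothesis, family form). -/
abbrev stub_absUpperInnerAL1 : Prop := (∀ k : ℕ, LuscherHamiltonianEigenfunctions k) → ∀ k : ℕ, OneSiteAbsUpperInner k

/-- (v9) = `(∀ k, LuscherHamiltonianEigenfunctions k) → ∀ k, OneSiteAbsLower k` (statement of the declared stub `stub_absLowerAL1`: the v5
quasimode floors with AL1 threaded as hypothesis, family form). -/
abbrev stub_absLowerAL1 : Prop := (∀ k : ℕ, LuscherHamiltonianEigenfunctions k) → ∀ k : ℕ, OneSiteAbsLower k

/-- (v7) = `∀ k, OneSiteAbsUpperOuter k` (statement of the declared stub `stub_absUpperOuter`). -/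
abbrev stub_absUpperOuter : Prop := ∀ k : ℕ, OneSiteAbsUpperOuter k

/-- (v8) = `∀ k, OneSiteAbsUpperValley k` (statement of the declared stub `stub_absUpperValley`). -/
abbrev stub_absUpperValley : Prop := ∀ k : ℕ, OneSiteAbsUpperValley k

/-- (v10) = `∀ k, OneSiteAbsUpperValleyMag k` (statement of the declared stub `stub_absUpperValleyMag`; the lead's CONCRETE valley: `Φ_B := magPhase (onePhaseScale B)`, all side conditions of VALLEY landed p448314/p448637/p448931/p449656). -/
abbrev stub_absUpperValleyMag : Prop := ∀ k : ℕ, OneSiteAbsUpperValleyMag k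

end Stmt

/- v3 (2026-08-26): discharged BY NAME from the landed support module `Theorems/FemtoTransferGapBounds.lean` (p413762, b60f800b40db). -/
theorem stub_oneSiteTopPos : Stmt.stub_oneSiteTopPos :=
  Summit.QuantumFields.YangMills.Theorems.FemtoTransferGap.oneSiteTopPos

/-- (v9) **FACT stub — NOT A PROVER TARGET.**  The reviewed named Literature fact AL1 `LuscherHamiltonianEigenfunctions k` for every `k`:
smooth, colour-invariant, `L²`-orthonormal, exponentially decaying classical eigenfunctions of `𝔥 = −½Δ + ¼Σ|x_i × x_j|²` realising the
min–max levels `physLevel 1 … physLevel (k+1)` [ReedSimonIV1978, Thm. XIII.64] [Agmon1982, Cor. 4.5, Thm. 5.1] [GilbargTrudinger2001,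
Thm. 6.2, Cor. 8.11] — KNOWN mathematics (spectral theorem for the Friedrichs extension + elliptic regularity + Agmon estimates) that neither
the tree nor Mathlib formalises.  It is threaded here so that the analytic stubs can be discharged BY NAME by theorems of the sanctioned shape
`(h : LuscherHamiltonianEigenfunctions k) → …`.  This sorry is discharged only by (i) a formalisation of AL1 (XL; unbounded-operator spectral
theory) or (ii) a ruling that admits printed-theorem hypotheses in the closure of a rung leaf (then crux ONE is re-typed at route level as
`(∀ k, LuscherHamiltonianEigenfunctions k) → …` and this stub disappears).  Fleet seats: do NOT work on it. -/
theorem stub_eigenAL1 : Stmt.stub_eigenAL1 := by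
  sorry

/-- (v9) XL CORE stub: the inner Kac/Trotter comparison (the HARD half of v5's `stub_absUpper`), AL1-conditional (family form): given the
eigenfunctions of `𝔥` for every level, for each `k` there are `k` physical constraints (intended: the pulled-back, cut-off, twist-symmetrised
`f_0 … f_{k−1}` in the scaling `c = λ_b x`, physical by `isPhys_pullback_of_isGaugeInv`) forcing the `cos Θ_B`-piece of every physical `ψ ⊥`
constraints down to the rate `linkCE B · e^{−E_kλ_b + Cλ_b²}`.  Flat-side input available from AL1 ALONE (owner's note, no spectral theorem): for
test `f ⊥ f_0 … f_{k−1}`, `physLevel (k+1) · ‖f‖² ≤ 𝔮(f)` (if `𝔮(f)/‖f‖² < E_{k+1}`, let `j₀` be least with `E_{j₀} = E_{k+1}`; `span(f_0 … f_{j₀−2}, f)`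
cut off at radius `R` has max Rayleigh quotient `≤ max(E_{j₀−1}, 𝔮(f)/‖f‖²) + O(e^{−R}) < E_{j₀} = physLevel j₀` for `R` large, contradicting
`physLevel = inf levelSet`; cross terms vanish by the eigen-equation and integration by parts).  Further functional-analytic infrastructure this
stub may need (Courant–Fischer for the compact kernel operator, Strang-type form bounds) is PROVABLE mathematics, not a named fact (card v2 §2).
[cite: HelfferSjostrand1984] [cite: SimonB1983DiscreteSpectrum, Cor. 4] [cite: ReedSimonIV1978, Thm. XIII.64] -/
theorem stub_absUpperInnerAL1 : Stmt.stub_absUpperInnerAL1 := by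
  sorry

/-- (v10) L stub: the CONCRETE VALLEY bound (lead g0 v9-draft): transverse zero-point confinement on `{S < 2√λ_b} ∩ {some link > √λ_b
from ±1}` for the explicit localisation `cos (magPhase (onePhaseScale B)) · sin (onePhase (onePhaseScale B)) · ψ`; no existential packaging left
(the eight side conditions of the v8/v9 VALLEY statement are theorems: Wilson-action link-Lipschitz p448314, `magPhase` defs/props p448637/p448931,
large fields p445976, seam p449656). [cite: SimonB1983DiscreteSpectrum, §2] [cite: Luscher1983, §2] -/
theorem stub_absUpperValleyMag : Stmt.stub_absUpperValleyMag := by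
  sorry

/- (v10) `stub_absUpperOuter` DISCHARGED modulo the CONCRETE valley stub by the landed seam `absUpperOuter_of_valleyMag` (p449656). -/
theorem stub_absUpperOuter : Stmt.stub_absUpperOuter := fun k => by
  obtain ⟨C₁, B₁, hB₁, h⟩ := stub_absUpperValleyMag k
  exact absUpperOuter_of_valleyMag k hB₁ h

/- (v10) the v8/v9 registered stub `stub_absUpperValley` (∃-packaged VALLEY) is NO LONGER on the composition path; it stays provable from
`stub_absUpperValleyMag` by exhibiting `Φ := magPhase ∘ onePhaseScale` with the landed side conditions (not needed by `OneSiteLevels_of_stubs`). -/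

/-- (v9) quasimode stub, AL1-conditional (family form): absolute floors `c(B)³e^{−E_kλ_b − Cλ_b²} ≤ μ_k` for every level from the pulled-back,
cut-off eigenfunctions of `𝔥` (seat ym-luscher-20007-p2's located line and card v2 §2: pull-back door `isPhys_pullback_of_isGaugeInv` p447138,
`l2_self_pos_of_continuous` p447339, door `le_levelValue_of_subspace` p438063, ℝ⁹ side `LuscherHamiltonianEigenfunctions.quasimodes` p446373, exact
magnetic factor `wilsonAction_one_site_le_of_forall` p440585, one-link kinetic Taylor expansion under the Markov kernel with the SHARP Laplace moment
`|linkM2 B / linkC B − 3/B| ≤ C/B²` — WANTED → lit, 13:16:15Z).  A theorem `(h : LuscherHamiltonianEigenfunctions k) : OneSiteAbsLower k` discharges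
it as `fun hAL1 k => thm (hAL1 k)`. [cite: ReedSimonIV1978, Thm. XIII.1–2] [cite: Luscher1983, §1] -/
theorem stub_absLowerAL1 : Stmt.stub_absLowerAL1 := by
  sorry

/- (v9) `stub_absUpper` (registered v5/v6) DISCHARGED modulo INNER-AL1 / OUTER (hence VALLEY) / the fact stub, by the landed composition
(`absUpper_of_inner_outer`; `oneLinkFactor = linkC`). -/
theorem stub_absUpper : Stmt.stub_absUpper :=
  fun k => absUpper_of_inner_outer k (stub_absUpperInnerAL1 stub_eigenAL1 k) (stub_absUpperOuter k)

/- (v9) `stub_absLower` (registered v5/v6) DISCHARGED modulo LOWER-AL1 / the fact stub. -/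
theorem stub_absLower : Stmt.stub_absLower :=
  stub_absLowerAL1 stub_eigenAL1

/- (v5) the registered v4 stubs, DISCHARGED modulo `stub_absUpper` / `stub_absLower` by the landed seams (p438063). -/
theorem stub_oneSiteEnergyLower : Stmt.stub_oneSiteEnergyLower :=
  oneSite_energyLower_of_abs (fun B => oneLinkFactor B ^ 3) stub_absUpper (stub_absLower 0)

theorem stub_oneSiteEnergyUpper : Stmt.stub_oneSiteEnergyUpper :=
  oneSite_energyUpper_of_abs (fun B => oneLinkFactor B ^ 3) stub_absLower (stub_absUpper 0)

/-- BC5 PLAN-ONLY rung (NOT used in the composition): the `k = 1`, one-sided instance — the tree's one-site leaf `FemtoGapOneSite`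
(`−log(λ₁/λ₀) ≥ ε₁λ_b − Cλ_b²`), numerically decidable (character-basis diagonalisation; Monte-Carlo check `job:j246127`/`j246168` of this seat)
and the first prover target of the crux (multi-well semiclassics for `−log K_B` at `L = 1`). -/
theorem stub_rungK1 : Stmt.stub_rungK1 := by
  sorry

/-- BC5 rung W1up (v4; NOT used in the composition): the order-of-magnitude quasimode half `e^{−Cλ_b} λ₀ ≤ λ₁` at `L = 1` — the
cheapest honest first rung of this crux (M-sized: explicit trial states + Schur bound, no localisation / IMS / Temple needed at this
precision); plan `RUNG-W1up-PLAN.md` (planner ym-beyond-p1 g12). -/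
theorem stub_rungW1up : Stmt.stub_rungW1up :=
  Summit.QuantumFields.YangMills.Theorems.FemtoTransferGap.rungUpperK1

/-- `0 ≤ λ_b` for `0 < B`. -/
theorem bareLambda_nonneg_of_pos {B : ℝ} (hB : 0 < B) : 0 ≤ bareLambda B := by
  unfold bareLambda
  exact Real.rpow_nonneg (by positivity) _

/-- `λ_b ≤ 1` for `2 ≤ B`. -/
theorem bareLambda_le_one_of_two_le {B : ℝ} (hB : 2 ≤ B) : bareLambda B ≤ 1 := by
  unfold bareLambda
  have hBpos : 0 < B := by linarith
  exact Real.rpow_le_one (by positivity) ((div_le_one hBpos).mpr hB) (by norm_num)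

/-- SEAM (proved): the rung is a corollary of the crux — instantiate `OneSiteLevels` at `k = 1`, keep its lower inequality, and absorb
`Δ₁λ_b + Cλ_b²` into `(|Δ₁| + |C|)·λ_b` for `B ≥ 2` (`0 ≤ λ_b ≤ 1`). -/
theorem rungW1up_of_oneSiteLevels (h : Summit.QuantumFields.YangMills.Theses.LuscherReduction.OneSiteLevels) :
    Stmt.stub_rungW1up := by
  show RungUpperK1
  unfold RungUpperK1
  obtain ⟨C, B0, H⟩ := h 1
  refine ⟨|levelGap 1| + |C|, max B0 2, fun B hB => ?_⟩
  have hB0 : B0 ≤ B := (le_max_left _ _).trans hB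
  have hB2 : 2 ≤ B := (le_max_right _ _).trans hB
  obtain ⟨hpos, -, hlow⟩ := H B hB0
  have hx0 : 0 ≤ bareLambda B := bareLambda_nonneg_of_pos (by linarith)
  have hx1 : bareLambda B ≤ 1 := bareLambda_le_one_of_two_le hB2
  have hsq : bareLambda B ^ 2 ≤ bareLambda B := by nlinarith
  have h1 : levelGap 1 * bareLambda B ≤ |levelGap 1| * bareLambda B :=
    mul_le_mul_of_nonneg_right (le_abs_self _) hx0
  have h2 : C * bareLambda B ^ 2 ≤ |C| * bareLambda B :=
    (mul_le_mul_of_nonneg_right (le_abs_self _) (sq_nonneg _)).trans (mul_le_mul_of_nonneg_left hsq (abs_nonneg _))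
  have hexp : Real.exp (-((|levelGap 1| + |C|) * bareLambda B)) ≤
      Real.exp (-(levelGap 1 * bareLambda B + C * bareLambda B ^ 2)) := by
    apply Real.exp_le_exp.mpr
    nlinarith
  exact (mul_le_mul_of_nonneg_right hexp hpos.le).trans hlow

/-- Composition: S_A1 → S_A2 → S_A3 → the crux, by name (`C := max C₂ C₃`, `B₀ := max (max B₂ B₃) 1`; monotonicity in `C` uses `λ₀ > 0`). -/
theorem OneSiteLevels_of (h₁ : Stmt.stub_oneSiteTopPos) (h₂ : Stmt.stub_oneSiteEnergyLower) (h₃ : Stmt.stub_oneSiteEnergyUpper) :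
    Summit.QuantumFields.YangMills.Theses.LuscherReduction.OneSiteLevels := by
  show Summit.QuantumFields.YangMills.Theorems.FemtoTransferGap.OneSiteLevels
  intro k
  obtain ⟨C₂, B₂, H₂⟩ := h₂ k
  obtain ⟨C₃, B₃, H₃⟩ := h₃ k
  refine ⟨max C₂ C₃, max (max B₂ B₃) 1, fun B hB => ?_⟩
  have hB2 : B₂ ≤ B := ((le_max_left B₂ B₃).trans (le_max_left _ _)).trans hB
  have hB3 : B₃ ≤ B := ((le_max_right B₂ B₃).trans (le_max_left _ _)).trans hB
  have hB1 : 1 ≤ B := (le_max_right _ _).trans hB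
  have hpos : 0 < levelValue su2Rep 1 B 0 := h₁ B hB1
  have ht : 0 ≤ bareLambda B ^ 2 := sq_nonneg _
  refine ⟨hpos, ?_, ?_⟩
  · have hexp : Real.exp (-(levelGap k * bareLambda B - C₂ * bareLambda B ^ 2)) ≤
        Real.exp (-(levelGap k * bareLambda B - max C₂ C₃ * bareLambda B ^ 2)) := by
      apply Real.exp_le_exp.mpr
      have := mul_le_mul_of_nonneg_right (le_max_left C₂ C₃) ht
      linarith
    exact (H₂ B hB2).trans (mul_le_mul_of_nonneg_right hexp hpos.le)
  · have hexp : Real.exp (-(levelGap k * bareLambda B + max C₂ C₃ * bareLambda B ^ 2)) ≤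
        Real.exp (-(levelGap k * bareLambda B + C₃ * bareLambda B ^ 2)) := by
      apply Real.exp_le_exp.mpr
      have := mul_le_mul_of_nonneg_right (le_max_right C₂ C₃) ht
      linarith
    exact (mul_le_mul_of_nonneg_right hexp hpos.le).trans (H₃ B hB3)

/-- The stubs discharge the composition (sanity). -/
theorem OneSiteLevels_of_stubs : Summit.QuantumFields.YangMills.Theses.LuscherReduction.OneSiteLevels :=
  OneSiteLevels_of stub_oneSiteTopPos stub_oneSiteEnergyLower stub_oneSiteEnergyUpper

/-- (v9) THE CONDITIONAL CLOSURE, kernel-checked shape: the fact AL1 and the three analytic stubs (statements by name) give the crux.  When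
`stub_absUpperInnerAL1`, `stub_absUpperValleyMag`, `stub_absLowerAL1` are theorems, this is the sorry-free theorem
`(∀ k, LuscherHamiltonianEigenfunctions k) → OneSiteLevels`. -/
theorem OneSiteLevels_of_AL1 (hAL1 : Stmt.stub_eigenAL1) (hin : Stmt.stub_absUpperInnerAL1) (hval : Stmt.stub_absUpperValleyMag)
    (hlow : Stmt.stub_absLowerAL1) : Summit.QuantumFields.YangMills.Theses.LuscherReduction.OneSiteLevels :=
  have hup : Stmt.stub_absUpper := fun k =>
    absUpper_of_inner_outer k (hin hAL1 k)
      (by obtain ⟨C₁, B₁, hB₁, h⟩ := hval k; exact absUpperOuter_of_valleyMag k hB₁ h)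
  have hlo : Stmt.stub_absLower := hlow hAL1
  OneSiteLevels_of stub_oneSiteTopPos
    (oneSite_energyLower_of_abs (fun B => oneLinkFactor B ^ 3) hup (hlo 0))
    (oneSite_energyUpper_of_abs (fun B => oneLinkFactor B ^ 3) hlo (hup 0))

/-- (v9 form, kept) the same conditional closure from the ∃-packaged VALLEY stub. -/
theorem OneSiteLevels_of_AL1_valley (hAL1 : Stmt.stub_eigenAL1) (hin : Stmt.stub_absUpperInnerAL1) (hval : Stmt.stub_absUpperValley)
    (hlow : Stmt.stub_absLowerAL1) : Summit.QuantumFields.YangMills.Theses.LuscherReduction.OneSiteLevels :=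
  have hup : Stmt.stub_absUpper :=
    fun k => absUpper_of_inner_outer k (hin hAL1 k) (absUpperOuter_of_absUpperValley k (hval k))
  have hlo : Stmt.stub_absLower := hlow hAL1
  OneSiteLevels_of stub_oneSiteTopPos
    (oneSite_energyLower_of_abs (fun B => oneLinkFactor B ^ 3) hup (hlo 0))
    (oneSite_energyUpper_of_abs (fun B => oneLinkFactor B ^ 3) hlo (hup 0))

end Summit.QuantumFields.YangMills.Cruxes.OneSiteLevels.Birth

end
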